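import Summits.BirchSwinnertonDyer.BirchSwinnertonDyer.Theorems.ThetaPartnerAtTwoMazurTateCongruenceAtTwoRLayerToLambda
import HarnessLib

/-!
# Crux `MazurTateCongruenceAtTwoTop` (stmt-BirchSwinnertonDyer-25797) = `MazurTateCongruenceAtTwoR` (21416), route-independent
# core, part 4: the CENSUS CURRENCY — `Ω⁺`-normalised, unit-free layer congruences `θ_n(f)·E ≡ θ_n(f_A)·E_A (mod 2, ω_n)`
# at all even `n` ⟺ `L♭·E − L♭_A·E_A ∈ 2Λ`

Cell `bsd-wall`, seat `bsd-wall-tp2-p1-w2` (WIDTH seat on the K1 row). THEOREMS ONLY (no `def`, no named fact, no `sorry`);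
no route file is imported.

WHAT. The cell's falsifier runs (FALSIFIER-V2MT-SPEC-v1, census g7/g10: 20/20 habitat pairs congruent at `n = 6, 8` with
`u = 1`; vet tp2mt g0: 131 140 pairs at `n = 0`) test, layer by layer, the congruence of the depleted Mazur–Tate elements of
the two newforms MODULO `(2, ω_n)` with NO unit and (modulo `2`, where an odd period ratio is `≡ 1`) NO period. This file
proves that this census currency, taken at ALL even layers, is EXACTLY the period-free, unit-free `Λ`-congruence of the
normal form (`…NormalForm.mazurTateCongruenceAtTwoR_iff_sub_mem_two`): for two weight-`2` cusp forms `f, f_A` with Pollack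
pairs `(L⁺, L⁻)`, `(L⁺_A, L⁻_A)` at `2` (POLLACK's labelling; `L♭ = kobayashiL 1 L⁺ L⁻ = L⁻`) and any `E, E_A ∈ Λ = ℤ₂⟦T⟧`,

  `(∀ n even, ∃ q r ∈ Λ, θ_n(f)·ιE − θ_n(f_A)·ιE_A = ι(2q + ω_n r))  ⟺  (∃ q ∈ Λ, L⁻·E − L⁻_A·E_A = 2q)`

(`forall_even_layer_sub_iff_sub`). Both directions are the landed cores at `ϖ = ϖ_A = 1`, `m = m' = 0`, `u = 1`:
`exists_layer_congruence_of_lambda_congruence` (Λ ⟹ layers, through the integrality transfer) and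
`lambda_congruence_two_of_layer_congruences` (layers ⟹ Λ, through `C_pow_dvd_of_layer_congruences`). Consequently ONE even
layer at which the two depleted `θ`-elements are INCONGRUENT mod `(2, ω_n)` refutes the `Λ`-congruence, hence (leaf file,
granted the PUB period-unit fact at `2`) the crux; and congruence at every even layer is equivalent to it. Nothing about any
curve is asserted; BSD is not proved by any of this.

References: R. Greenberg, V. Vatsal, Invent. Math. 142 (2000) §3, (13) [GreenbergVatsal2000]; R. Pollack, Duke Math. J. 118
(2003) Prop. 6.18 [Pollack2003].
-/

set_option linter.dupNamespace false
set_option autoImplicit false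

noncomputable section

open scoped Classical MatrixGroups ModularForm

open CongruenceSubgroup Polynomial
  Literature.NumberTheory.EllipticCurves Literature.NumberTheory.EllipticCurves.Sprung2017
  Summit.BirchSwinnertonDyer.Rank1Residual.Supersingular

namespace Summit.BirchSwinnertonDyer.BirchSwinnertonDyer.Theorems.MazurTateCongruenceAtTwoR

section Census

variable {N NA : ℕ} (f : CuspForm (Gamma0 N) 2) (fA : CuspForm (Gamma0 NA) 2)
  {Lplus Lminus LplusA LminusA : IwasawaAlgebra 2}

/-- **Λ ⟹ every even layer, unit-free and period-free.** If `L⁻·E − L⁻_A·E_A = 2q` in `Λ`, then at every even layer `n`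
`θ_n(f)·ιE − θ_n(f_A)·ιE_A = ι(2q' + ω_n r)` for some `q', r ∈ Λ` (Pollack pairs at `2`, POLLACK's labelling).
[cite: GreenbergVatsal2000, §3, (13)] [cite: Pollack2003, Prop. 6.18] -/
theorem even_layer_sub_of_sub (hPP : IsPollackPair f 2 Lplus Lminus) (hPPA : IsPollackPair fA 2 LplusA LminusA)
    {E EA q : IwasawaAlgebra 2} (hq : Lminus * E - LminusA * EA = PowerSeries.C (2 : ℤ_[2]) * q)
    {n : ℕ} (hn : Even n) :
    ∃ q' r : IwasawaAlgebra 2,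
      ((mazurTateElement f 2 n).map (algebraMap ℚ ℚ_[2]) : PowerSeries ℚ_[2]) * iwasawaToPowerSeries 2 E -
          ((mazurTateElement fA 2 n).map (algebraMap ℚ ℚ_[2]) : PowerSeries ℚ_[2]) * iwasawaToPowerSeries 2 EA =
        iwasawaToPowerSeries 2 (PowerSeries.C (2 : ℤ_[2]) * q' + toIwasawa 2 (cyclotomicOmega 2 n) * r) := by
  have hG : iwasawaToPowerSeries 2 Lminus = PowerSeries.C (1 : ℚ_[2]) * iwasawaToPowerSeries 2 Lminus := by
    rw [map_one, one_mul]
  have hGA : iwasawaToPowerSeries 2 LminusA = PowerSeries.C (1 : ℚ_[2]) * iwasawaToPowerSeries 2 LminusA := by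
    rw [map_one, one_mul]
  have hΛ : PowerSeries.C (1 : ℤ_[2]) * Lminus * E - PowerSeries.C (1 : ℤ_[2]) * LminusA * EA =
      PowerSeries.C (((2 : ℕ) : ℤ_[2]) ^ 1) * q := by
    rw [map_one, one_mul, one_mul, pow_one, Nat.cast_ofNat, hq]
  obtain ⟨q', r, h⟩ := exists_layer_congruence_of_lambda_congruence (hPP.2.2.2 n hn) (hPPA.2.2.2 n hn)
    (natDegree_mazurTateElement_lt f 2 n) (natDegree_mazurTateElement_lt fA 2 n) hG hGA hΛ
  refine ⟨q', r, ?_⟩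
  simp only [PadicInt.coe_one, map_one, one_mul, pow_one, Nat.cast_ofNat] at h
  rw [show toIwasawa 2 (cyclotomicOmega 2 n) =
      (((cyclotomicOmega 2 n).map (Int.castRingHom ℤ_[2]) : ℤ_[2][X]) : PowerSeries ℤ_[2]) from rfl]
  exact h

/-- **Every even layer ⟹ Λ, unit-free and period-free.** If at every even layer `n` the depleted elements satisfy
`θ_n(f)·ιE − θ_n(f_A)·ιE_A = ι(2q + ω_n r)` (some `q, r ∈ Λ`), then `L⁻·E − L⁻_A·E_A ∈ 2Λ`.
[cite: GreenbergVatsal2000, §3, (13)] [cite: Pollack2003, Prop. 6.18] -/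
theorem sub_of_forall_even_layer_sub (hPP : IsPollackPair f 2 Lplus Lminus) (hPPA : IsPollackPair fA 2 LplusA LminusA)
    {E EA : IwasawaAlgebra 2}
    (h : ∀ n : ℕ, Even n → ∃ q r : IwasawaAlgebra 2,
      ((mazurTateElement f 2 n).map (algebraMap ℚ ℚ_[2]) : PowerSeries ℚ_[2]) * iwasawaToPowerSeries 2 E -
          ((mazurTateElement fA 2 n).map (algebraMap ℚ ℚ_[2]) : PowerSeries ℚ_[2]) * iwasawaToPowerSeries 2 EA =
        iwasawaToPowerSeries 2 (PowerSeries.C (2 : ℤ_[2]) * q + toIwasawa 2 (cyclotomicOmega 2 n) * r)) :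
    ∃ q : IwasawaAlgebra 2, Lminus * E - LminusA * EA = PowerSeries.C (2 : ℤ_[2]) * q := by
  have hK : kobayashiL (1 : ℤˣ) Lplus Lminus = Lminus := if_pos rfl
  have hKA : kobayashiL (1 : ℤˣ) LplusA LminusA = LminusA := if_pos rfl
  -- the unit multiples `G = L⁻`, `G_A = L⁻_A` (`ϖ = ϖ_A = 1`, `m = m' = 0`)
  have e2 : PowerSeries.C ((2 : ℚ_[2]) ^ 0 * ((1 : ℚ) : ℚ_[2])) = 1 := by
    rw [pow_zero, Rat.cast_one, mul_one, map_one]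
  have hG : iwasawaToPowerSeries 2 Lminus =
      PowerSeries.C ((2 : ℚ_[2]) ^ 0 * ((1 : ℚ) : ℚ_[2])) * iwasawaToPowerSeries 2 (kobayashiL 1 Lplus Lminus) := by
    rw [e2, hK, one_mul]
  have hGA : iwasawaToPowerSeries 2 LminusA =
      PowerSeries.C ((2 : ℚ_[2]) ^ 0 * ((1 : ℚ) : ℚ_[2])) * iwasawaToPowerSeries 2 (kobayashiL 1 LplusA LminusA) := by
    rw [e2, hKA, one_mul]
  -- the clean layer congruences, dressed in the crux's binder shape at `u = 1`
  have e1 : PowerSeries.C (((2 : ℤ_[2]) ^ 0 : ℤ_[2]) : ℚ_[2]) = 1 := by rw [pow_zero, PadicInt.coe_one, map_one]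
  have e3 : PowerSeries.C ((((1 : ℤ_[2]ˣ) : ℤ_[2]) * (2 : ℤ_[2]) ^ 0 : ℤ_[2]) : ℚ_[2]) = 1 := by
    rw [Units.val_one, pow_zero, mul_one, PadicInt.coe_one, map_one]
  have e4 : (PowerSeries.C ((2 : ℤ_[2]) ^ (0 + 0 + 1)) : IwasawaAlgebra 2) = PowerSeries.C (2 : ℤ_[2]) := by
    rw [zero_add, zero_add, pow_one]
  have hMT : ∀ n : ℕ, Even n → ∃ q r : IwasawaAlgebra 2,
      PowerSeries.C (((2 : ℤ_[2]) ^ 0 : ℤ_[2]) : ℚ_[2]) *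
          (PowerSeries.C ((2 : ℚ_[2]) ^ 0 * ((1 : ℚ) : ℚ_[2])) *
            ((mazurTateElement f 2 n).map (algebraMap ℚ ℚ_[2]) : PowerSeries ℚ_[2]) *
            iwasawaToPowerSeries 2 E) -
        PowerSeries.C ((((1 : ℤ_[2]ˣ) : ℤ_[2]) * (2 : ℤ_[2]) ^ 0 : ℤ_[2]) : ℚ_[2]) *
          (PowerSeries.C ((2 : ℚ_[2]) ^ 0 * ((1 : ℚ) : ℚ_[2])) *
            ((mazurTateElement fA 2 n).map (algebraMap ℚ ℚ_[2]) : PowerSeries ℚ_[2]) *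
            iwasawaToPowerSeries 2 EA) =
      iwasawaToPowerSeries 2
        (PowerSeries.C ((2 : ℤ_[2]) ^ (0 + 0 + 1)) * q + toIwasawa 2 (cyclotomicOmega 2 n) * r) := by
    intro n hn
    obtain ⟨q, r, hqr⟩ := h n hn
    refine ⟨q, r, ?_⟩
    simp only [e1, e2, e3, e4, one_mul]
    exact hqr
  obtain ⟨q₀, hq₀⟩ := lambda_congruence_two_of_layer_congruences f fA hPP hPPA hG hGA hMT
  refine ⟨q₀, ?_⟩
  simp only [pow_zero, map_one, one_mul, Units.val_one, mul_one, e4] at hq₀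
  exact hq₀

/-- **The census currency IS the `Λ`-congruence.** For Pollack pairs of `f, f_A` at `2` and any `E, E_A ∈ Λ`:
`(∀ n even, θ_n(f)·ιE − θ_n(f_A)·ιE_A ∈ ι((2, ω_n)Λ)) ⟺ (L⁻·E − L⁻_A·E_A ∈ 2Λ)` — no unit, no period, no integral
multiple. With the leaf `…NormalForm` (PUB period-unit fact at `2`): ⟺ the crux `MazurTateCongruenceAtTwoR`.
[cite: GreenbergVatsal2000, §3, (13)] [cite: Pollack2003, Prop. 6.18] -/
theorem forall_even_layer_sub_iff_sub (hPP : IsPollackPair f 2 Lplus Lminus) (hPPA : IsPollackPair fA 2 LplusA LminusA)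
    (E EA : IwasawaAlgebra 2) :
    (∀ n : ℕ, Even n → ∃ q r : IwasawaAlgebra 2,
      ((mazurTateElement f 2 n).map (algebraMap ℚ ℚ_[2]) : PowerSeries ℚ_[2]) * iwasawaToPowerSeries 2 E -
          ((mazurTateElement fA 2 n).map (algebraMap ℚ ℚ_[2]) : PowerSeries ℚ_[2]) * iwasawaToPowerSeries 2 EA =
        iwasawaToPowerSeries 2 (PowerSeries.C (2 : ℤ_[2]) * q + toIwasawa 2 (cyclotomicOmega 2 n) * r)) ↔
      ∃ q : IwasawaAlgebra 2, Lminus * E - LminusA * EA = PowerSeries.C (2 : ℤ_[2]) * q :=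
  ⟨sub_of_forall_even_layer_sub f fA hPP hPPA, fun ⟨_, hq⟩ _ hn ↦ even_layer_sub_of_sub f fA hPP hPPA hq hn⟩

end Census

end Summit.BirchSwinnertonDyer.BirchSwinnertonDyer.Theorems.MazurTateCongruenceAtTwoR

end
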